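import Summits.NavierStokesRegularity.FluidComputer.DampedTransition

/-!
# Tao's delay gate from a CLOCK HEAD-START, part 1: the input class, energy law, signs, (ob-2)

PLACEMENT: cell-own derived work of `pub-fluidc` (blueprint seat bp1, owner of the Tao-2016 skeleton
`Literature/Analysis/FluidPDE/Tao2016AveragedNS/` and of its dictionary), filed under the host summit's topic
directory `Summits/NavierStokesRegularity/FluidComputer/` next to `DampedTransition*.lean` (whose §0 tools and
component equations it reuses by name). ONE text in several files (400-line rule), one namespace
`Summit.NavierStokesRegularity.FluidComputer.HeadStart`. The Literature vocabulary (`delayCircuitWith`,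
`delayInit`, `energy`, `IsCancelling`, the `Thm53` toolkit) is opened, never modified.

HONEST FRAMING (cell `pub-fluidc`, verbatim): *low prior, high value-of-information experiment on Tao's
machine paradigm; NOT a claim that NS blows up.* Everything in these files concerns the five-mode quadratic
truncation (5.5) of [Tao2016AveragedNS, §5.5] in the retuned form `delayCircuitWith K M ε` of
`GateRetuning.lean` (seed `ε²e^{-M}`, amplifier `ε⁻¹M`), with the added diagonal damping `-E(t) * X` of
`DampedTransition.lean` (`0 ≤ Eᵢ(t) ≤ η` on `[0,2]`, no regularity); nothing is said about the
Navier–Stokes equations.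

## The question (positive counterpart of `DampedTransitionMisfire.lean` / `DampedTransitionPrefire.lean`)

In a cascade of gates the clock `b` of the downstream gate is pumped by `+ε a²  ≥ 0` during the upstream
transient, so at hand-off the downstream gate does NOT start from Tao's datum `(1,0,0,0,0)` but with a
clock pre-load `b(0) = b₀ = h·ε` of either sign ("head-start `h`", in units of the clock rate; the
hand-off audit of this cell reads the contract as `|h| < 1/2`). The misfire/prefire files show that a
pre-load `|b₀| ≥ 10ε` is fatal (no criticality on `[0,2]`, resp. criticality by time `1`); no theorem of the
cell covered `0 < |b₀| ≪ 10ε` beyond the seed scale `ε²e^{-M}/√M` of the isotropic reach certificates.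
These files re-run the damped bootstrap of `DampedTransition*.lean` ([Tao2016AveragedNS, Theorem 5.3],
printed architecture of `RetunedTransition.lean`) from the INPUT CLASS

  `HS(ε)`:  `X(0) = (a₀, b₀, 0, 0, 0)`, `a₀ ≥ 0`, `a₀² + b₀² = 1`, `-(1/5)·ε ≤ b₀ ≤ (2/5)·ε`

(the energy-normalised representative, under the gate's exact scaling covariance `X ↦ eX(e·)`, of every
input `(a, b, 0, 0, 0)` with `a > 0`, `-ε/5 ≤ b/a ≤ 2ε/5`; it CONTAINS Tao's datum, `b₀ = 0`). RESULT of
the text: the gate still fires, with the SAME able/beable boxes, at a critical time `t_c` with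
`|t_c + h - √(2 + h²)| = O(log K/M + η + h₋²)` (`h₋ = max(-h, 0)`): a POSITIVE head-start `h ≤ 2/5`
ADVANCES the abrupt transition to `√(2 + h²) - h` (by at most `h`), a NEGATIVE one `h ≥ -1/5` DELAYS it
to `|h| + √2 + O(h²)`, and nothing else changes. MECHANISM: the trigger's sweep rate is
`ε⁻¹Mb = M(h + t)(1 + O(θ))`, so its Gaussian clock `e^{Mt²/2}` becomes `e^{M(t²/2 + ht)}` (for `h < 0`
the super-solution completes the square: `e^{M((t+h)²/2)}` up to `θ`); the one place of the printed
proof that used `b(0) = 0` essentially — the sub-solution's first stage on `[0, K⁻⁵]`, where the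
integrating factor had to stay `≥ 1/2` — is re-done on `[0, (2(K⁵ + M))⁻¹]` (factor `≥ 2/3`), at the
price `4K⁵ ↦ 12K¹⁰` in the sub-solution's constant and `2/M ↦ 10/M` in the late edge of `t_c`.

## Contents of this file

* the class `HS(ε)` is written out in every signature as the explicit hypothesis
  `h0 : a₀² + b₀² = 1 ∧ 0 ≤ a₀ ∧ -(1/5)ε ≤ b₀ ∧ b₀ ≤ (2/5)ε ∧ c₀ = 0 ∧ d₀ = 0 ∧ ã₀ = 0` on `X 0` (NO new
  definitions are introduced); bookkeeping `hs_energy`, `hs_a_le_one`, `hs_one_sub_le_a`, `hs_b_sq_le`,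
  and membership of the explicit data `(√(1-b₀²), b₀, 0, 0, 0)` (`hs_of_explicit`) and `delayInit`
  (`hs_of_delayInit`, Tao's datum, `b₀ = 0`).
* the damped member on `[0,2]` from the class: `energy_le_one`, `energy_ge_exp`, `traj_abs_le_one`,
  `e_nonneg`; (ob-2) `bc_small` (`|b|,|c| ≤ 5ε` — the auxiliary `√(b² + c² + ε² - b₀²)` starts at `ε`
  exactly); `c_nonneg`.

## What is NOT claimed (all files of the text)

(i) Head-starts `h > 2/5` or `h < -1/5`, and pre-loads of the trigger `c` or of `d, ã` are not
treated (for `|h| ≥ 10` see the misfire/prefire files). (ii) `-1/5 ≤ h ≤ 2/5`, `η ≤ 1/1000` are sufficient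
constants read off the printed absorptions, not thresholds. (iii) Nothing about the averaged or true
Navier–Stokes equations, blow-up, or Tao's infinite circuit.

Sources: [cite: Tao2016AveragedNS, §5.5 Thm 5.3, (5.5), proof pp. 28–30 (ob-2)]; energy law and sign
barrier [folklore], reused from `DampedTransition.lean`. No named facts (D-0026); 0 sorry.
-/

noncomputable section

namespace Summit.NavierStokesRegularity.FluidComputer

open Real Set Filter Topology
open Literature.Analysis.FluidPDE.Tao2016AveragedNS
open Literature.Analysis.FluidPDE.Tao2016AveragedNS.Thm53 (antitoneOn_intFactor monotoneOn_intFactor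
  antitoneOn_sub_of_deriv_le monotoneOn_sub_of_le_deriv abs_sub_le_of_abs_deriv_le)
open DampedTransition (energy_antitoneOn_damped energy_mul_exp_monotoneOn_damped nonneg_of_deriv_barrier
  hasDerivAt_a hasDerivAt_b hasDerivAt_c hasDerivAt_d hasDerivAt_e bc_energy out_energy)

namespace HeadStart

/-! ## §1. The input class `HS(ε)` (an explicit conjunction; bookkeeping) -/

section InitFacts

variable {ε : ℝ} {p : Fin 5 → ℝ}

/-- The class has unit energy. [folklore] -/
theorem hs_energy (h0 : p 0 ^ 2 + p 1 ^ 2 = 1 ∧ 0 ≤ p 0 ∧ -(1 / 5 * ε) ≤ p 1 ∧ p 1 ≤ 2 / 5 * ε ∧ p 2 = 0 ∧ p 3 = 0 ∧ p 4 = 0) :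
    energy p = 1 := by
  obtain ⟨hsq, -, -, -, hc, hd, he⟩ := h0
  simp only [Literature.Analysis.FluidPDE.Tao2016AveragedNS.energy, Fin.sum_univ_five, hc, hd, he]
  nlinarith

/-- `a₀ ≤ 1`. [folklore] -/
theorem hs_a_le_one (h0 : p 0 ^ 2 + p 1 ^ 2 = 1 ∧ 0 ≤ p 0 ∧ -(1 / 5 * ε) ≤ p 1 ∧ p 1 ≤ 2 / 5 * ε ∧ p 2 = 0 ∧ p 3 = 0 ∧ p 4 = 0) :
    p 0 ≤ 1 := by
  nlinarith [h0.1, sq_nonneg (p 1), h0.2.1]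

/-- `a₀ ≥ 1 - b₀²` (as `a₀ ≥ a₀² = 1 - b₀²`). [folklore] -/
theorem hs_one_sub_le_a
    (h0 : p 0 ^ 2 + p 1 ^ 2 = 1 ∧ 0 ≤ p 0 ∧ -(1 / 5 * ε) ≤ p 1 ∧ p 1 ≤ 2 / 5 * ε ∧ p 2 = 0 ∧ p 3 = 0 ∧ p 4 = 0) :
    1 - p 1 ^ 2 ≤ p 0 := by
  have h1 : p 0 ^ 2 ≤ p 0 := by nlinarith [hs_a_le_one h0, h0.2.1]
  nlinarith [h0.1]

/-- `b₀² ≤ (4/25)ε²` (from `-ε/5 ≤ b₀ ≤ 2ε/5`: `(b₀ + ε/5)(2ε/5 - b₀) ≥ 0`). [folklore] -/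
theorem hs_b_sq_le (h0 : p 0 ^ 2 + p 1 ^ 2 = 1 ∧ 0 ≤ p 0 ∧ -(1 / 5 * ε) ≤ p 1 ∧ p 1 ≤ 2 / 5 * ε ∧ p 2 = 0 ∧ p 3 = 0 ∧ p 4 = 0) :
    p 1 ^ 2 ≤ 4 / 25 * ε ^ 2 := by
  have h1 := h0.2.2.1
  have h2 := h0.2.2.2.1
  have hε : 0 ≤ ε := by linarith
  nlinarith [mul_nonneg (sub_nonneg.2 h2) (by linarith : 0 ≤ p 1 + 1 / 5 * ε), mul_nonneg hε (sub_nonneg.2 h2)]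

/-- The explicit datum `(√(1 - b₀²), b₀, 0, 0, 0)` is in the class for `-ε/5 ≤ b₀ ≤ 2ε/5`, `ε ≤ 1`. [folklore] -/
theorem hs_of_explicit {b₀ : ℝ} (hε1 : ε ≤ 1) (hb0 : -(1 / 5 * ε) ≤ b₀) (hb : b₀ ≤ 2 / 5 * ε)
    (h0 : p = ![sqrt (1 - b₀ ^ 2), b₀, 0, 0, 0]) :
    p 0 ^ 2 + p 1 ^ 2 = 1 ∧ 0 ≤ p 0 ∧ -(1 / 5 * ε) ≤ p 1 ∧ p 1 ≤ 2 / 5 * ε ∧ p 2 = 0 ∧ p 3 = 0 ∧ p 4 = 0 := by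
  subst h0
  have hε : 0 ≤ ε := by linarith
  have hx : b₀ ^ 2 ≤ 1 := by
    nlinarith [mul_nonneg (sub_nonneg.2 hb) (by linarith : 0 ≤ b₀ + 1 / 5 * ε), mul_nonneg hε (sub_nonneg.2 hb)]
  have e0 : (![sqrt (1 - b₀ ^ 2), b₀, 0, 0, 0] : Fin 5 → ℝ) 0 = sqrt (1 - b₀ ^ 2) := by simp
  have e1 : (![sqrt (1 - b₀ ^ 2), b₀, 0, 0, 0] : Fin 5 → ℝ) 1 = b₀ := by simp
  refine ⟨?_, ?_, ?_, ?_, by simp, by simp, by simp⟩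
  · rw [e0, e1, sq_sqrt (by linarith)]; ring
  · rw [e0]; exact sqrt_nonneg _
  · rw [e1]; exact hb0
  · rw [e1]; exact hb

/-- Tao's datum `(1,0,0,0,0)` is in the class (`b₀ = 0`) for `ε ≥ 0`. [cite: Tao2016AveragedNS, §5.5 (5.6)] -/
theorem hs_of_delayInit (hε : 0 ≤ ε) (h0 : p = delayInit) :
    p 0 ^ 2 + p 1 ^ 2 = 1 ∧ 0 ≤ p 0 ∧ -(1 / 5 * ε) ≤ p 1 ∧ p 1 ≤ 2 / 5 * ε ∧ p 2 = 0 ∧ p 3 = 0 ∧ p 4 = 0 := by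
  subst h0
  have e1 : delayInit 1 = 0 := by simp [delayInit]
  refine ⟨by simp [delayInit], by simp [delayInit], ?_, ?_, by simp [delayInit],
    by simp [delayInit], by simp [delayInit]⟩
  · rw [e1]; linarith
  · rw [e1]; linarith

end InitFacts

/-! ## §2. The damped member from the class: energy, signs, (ob-2) -/

section Trajectory

variable {K M ε η : ℝ} {E X : ℝ → Fin 5 → ℝ}

/-- (energy-con) becomes energy DECAY: `|X(t)|² ≤ 1` for `t ≥ 0`. [cite: Tao2016AveragedNS, §5.5 (energy-con)] -/
theorem energy_le_one
    (hX : ∀ t ∈ Icc (0:ℝ) 2, HasDerivAt X (delayCircuitWith K M ε (X t) - E t * X t) t)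
    (hE : ∀ t ∈ Icc (0:ℝ) 2, ∀ i, 0 ≤ E t i ∧ E t i ≤ η)
    (h0 : X 0 0 ^ 2 + X 0 1 ^ 2 = 1 ∧ 0 ≤ X 0 0 ∧ -(1 / 5 * ε) ≤ X 0 1 ∧ X 0 1 ≤ 2 / 5 * ε ∧ X 0 2 = 0 ∧ X 0 3 = 0 ∧ X 0 4 = 0)
    {t : ℝ}
    (ht : t ∈ Icc (0:ℝ) 2) : energy (X t) ≤ 1 := by
  have h := energy_antitoneOn_damped (isCancelling_delayCircuitWith K M ε) (convex_Icc 0 2) hX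
    (fun t ht i => (hE t ht i).1) ⟨le_rfl, zero_le_two⟩ ht ht.1
  have h1 : energy (X 0) = 1 := hs_energy h0
  simpa [h1] using h

/-- … and `|X(t)|² ≥ e^{-2ηt}`. [folklore] -/
theorem energy_ge_exp
    (hX : ∀ t ∈ Icc (0:ℝ) 2, HasDerivAt X (delayCircuitWith K M ε (X t) - E t * X t) t)
    (hE : ∀ t ∈ Icc (0:ℝ) 2, ∀ i, 0 ≤ E t i ∧ E t i ≤ η)
    (h0 : X 0 0 ^ 2 + X 0 1 ^ 2 = 1 ∧ 0 ≤ X 0 0 ∧ -(1 / 5 * ε) ≤ X 0 1 ∧ X 0 1 ≤ 2 / 5 * ε ∧ X 0 2 = 0 ∧ X 0 3 = 0 ∧ X 0 4 = 0)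
    {t : ℝ}
    (ht : t ∈ Icc (0:ℝ) 2) : exp (-(2 * η * t)) ≤ energy (X t) := by
  have h := energy_mul_exp_monotoneOn_damped (isCancelling_delayCircuitWith K M ε) (convex_Icc 0 2) hX
    (fun t ht i => (hE t ht i).2) ⟨le_rfl, zero_le_two⟩ ht ht.1
  have h1 : energy (X 0) = 1 := hs_energy h0
  simp only [h1, mul_zero, exp_zero, one_mul] at h
  rw [exp_neg, inv_le_iff_one_le_mul₀ (exp_pos _)]
  exact h

/-- (est): `Xᵢ² ≤ 1` for `t ≥ 0`. [cite: Tao2016AveragedNS, §5.5 (est)] -/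
theorem traj_sq_le_one
    (hX : ∀ t ∈ Icc (0:ℝ) 2, HasDerivAt X (delayCircuitWith K M ε (X t) - E t * X t) t)
    (hE : ∀ t ∈ Icc (0:ℝ) 2, ∀ i, 0 ≤ E t i ∧ E t i ≤ η)
    (h0 : X 0 0 ^ 2 + X 0 1 ^ 2 = 1 ∧ 0 ≤ X 0 0 ∧ -(1 / 5 * ε) ≤ X 0 1 ∧ X 0 1 ≤ 2 / 5 * ε ∧ X 0 2 = 0 ∧ X 0 3 = 0 ∧ X 0 4 = 0)
    {t : ℝ}
    (ht : t ∈ Icc (0:ℝ) 2) (i : Fin 5) : X t i ^ 2 ≤ 1 := by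
  have h := energy_le_one hX hE h0 ht
  rw [energy] at h
  exact le_trans (Finset.single_le_sum (f := fun j => X t j ^ 2) (fun j _ => sq_nonneg (X t j))
    (Finset.mem_univ i)) h

/-- (est): `|Xᵢ| ≤ 1` for `t ≥ 0`. [cite: Tao2016AveragedNS, §5.5 (est)] -/
theorem traj_abs_le_one
    (hX : ∀ t ∈ Icc (0:ℝ) 2, HasDerivAt X (delayCircuitWith K M ε (X t) - E t * X t) t)
    (hE : ∀ t ∈ Icc (0:ℝ) 2, ∀ i, 0 ≤ E t i ∧ E t i ≤ η)
    (h0 : X 0 0 ^ 2 + X 0 1 ^ 2 = 1 ∧ 0 ≤ X 0 0 ∧ -(1 / 5 * ε) ≤ X 0 1 ∧ X 0 1 ≤ 2 / 5 * ε ∧ X 0 2 = 0 ∧ X 0 3 = 0 ∧ X 0 4 = 0)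
    {t : ℝ}
    (ht : t ∈ Icc (0:ℝ) 2) (i : Fin 5) : |X t i| ≤ 1 :=
  sq_le_one_iff_abs_le_one _ |>.1 (traj_sq_le_one hX hE h0 ht i)

/-- `ã ≥ 0` for `t ≥ 0` (sign barrier: `∂ₜã = Kd² - E₄ã ≥ 0` wherever `ã < 0`).
[cite: Tao2016AveragedNS, §5.5 proof] -/
theorem e_nonneg
    (hX : ∀ t ∈ Icc (0:ℝ) 2, HasDerivAt X (delayCircuitWith K M ε (X t) - E t * X t) t)
    (hE : ∀ t ∈ Icc (0:ℝ) 2, ∀ i, 0 ≤ E t i ∧ E t i ≤ η)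
    (h0 : X 0 0 ^ 2 + X 0 1 ^ 2 = 1 ∧ 0 ≤ X 0 0 ∧ -(1 / 5 * ε) ≤ X 0 1 ∧ X 0 1 ≤ 2 / 5 * ε ∧ X 0 2 = 0 ∧ X 0 3 = 0 ∧ X 0 4 = 0)
    (hK : 0 ≤ K) {t : ℝ}
    (ht : t ∈ Icc (0:ℝ) 2) : 0 ≤ X t 4 := by
  refine nonneg_of_deriv_barrier (L := 0) (b := t) le_rfl
    (fun s hs => hasDerivAt_e (hX s ⟨hs.1, hs.2.trans ht.2⟩)) (by rw [h0.2.2.2.2.2.2])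
    (fun s hs hs' => ?_) ⟨ht.1, le_rfl⟩
  have h1 : 0 ≤ K * X s 3 ^ 2 := by positivity
  have h2 : 0 ≤ -(E s 4 * X s 4) := by
    rw [neg_nonneg]
    exact mul_nonpos_of_nonneg_of_nonpos (hE s ⟨hs.1, hs.2.le.trans ht.2⟩ 4).1 hs'.le
  linarith

/-- (ob-2) from the class: `|b|, |c| ≤ 5ε` on `[0,2]` — apply `∂ₜ(b²+c²) ≤ 2εa²b + 2ε²e^{-M}a²c` to
`√(b² + c² + (ε² - b₀²))`, which starts at `ε` exactly (`b₀² ≤ 4ε²/25 < ε²`) and grows at rate `≤ 2ε`.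
[cite: Tao2016AveragedNS, §5.5 (ob-2)] -/
theorem bc_small
    (hX : ∀ t ∈ Icc (0:ℝ) 2, HasDerivAt X (delayCircuitWith K M ε (X t) - E t * X t) t)
    (hE : ∀ t ∈ Icc (0:ℝ) 2, ∀ i, 0 ≤ E t i ∧ E t i ≤ η)
    (h0 : X 0 0 ^ 2 + X 0 1 ^ 2 = 1 ∧ 0 ≤ X 0 0 ∧ -(1 / 5 * ε) ≤ X 0 1 ∧ X 0 1 ≤ 2 / 5 * ε ∧ X 0 2 = 0 ∧ X 0 3 = 0 ∧ X 0 4 = 0)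
    (hε : 0 < ε) (hε1 : ε ≤ 1) (hM0 : 0 ≤ M) {t : ℝ} (ht : t ∈ Icc 0 2) :
    |X t 1| ≤ 5 * ε ∧ |X t 2| ≤ 5 * ε := by
  set ρ : ℝ := ε ^ 2 - X 0 1 ^ 2 with hρ
  have hρ0 : 0 < ρ := by have := hs_b_sq_le h0; simp only [hρ]; nlinarith [pow_pos hε 2]
  set f : ℝ → ℝ := fun s => X s 1 ^ 2 + X s 2 ^ 2 with hf
  set h : ℝ → ℝ := fun s => sqrt (f s + ρ) with hh
  have hfpos : ∀ s, 0 < f s + ρ := fun s => by positivity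
  have hb_le : ∀ s, |X s 1| ≤ h s := fun s =>
    abs_le_sqrt (by simp only [hf]; nlinarith [sq_nonneg (X s 2)])
  have hc_le : ∀ s, |X s 2| ≤ h s := fun s =>
    abs_le_sqrt (by simp only [hf]; nlinarith [sq_nonneg (X s 1)])
  have hder : ∀ s ∈ Icc (0:ℝ) 2, HasDerivAt h
      ((2 * ε * X s 0 ^ 2 * X s 1 + 2 * ε ^ 2 * exp (-M) * X s 0 ^ 2 * X s 2
        - 2 * E s 1 * X s 1 ^ 2 - 2 * E s 2 * X s 2 ^ 2) / (2 * sqrt (f s + ρ))) s :=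
    fun s hs => ((bc_energy (hX s hs)).add_const ρ).sqrt (hfpos s).ne'
  have hbound : ∀ s ∈ Icc (0:ℝ) 2,
      (2 * ε * X s 0 ^ 2 * X s 1 + 2 * ε ^ 2 * exp (-M) * X s 0 ^ 2 * X s 2
        - 2 * E s 1 * X s 1 ^ 2 - 2 * E s 2 * X s 2 ^ 2) / (2 * sqrt (f s + ρ)) ≤ 2 * ε := by
    intro s hs
    have hhpos : 0 < sqrt (f s + ρ) := sqrt_pos.2 (hfpos s)
    rw [div_le_iff₀ (by positivity)]
    have ha : X s 0 ^ 2 ≤ 1 := traj_sq_le_one hX hE h0 hs 0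
    have ha0 : 0 ≤ X s 0 ^ 2 := sq_nonneg _
    have hek : exp (-M) ≤ 1 := by rw [exp_le_one_iff, neg_nonpos]; exact hM0
    have hb1 : X s 1 ≤ h s := (le_abs_self _).trans (hb_le s)
    have hc1 : X s 2 ≤ h s := (le_abs_self _).trans (hc_le s)
    have hh0 : 0 ≤ h s := (abs_nonneg _).trans (hb_le s)
    have h1 : X s 0 ^ 2 * X s 1 ≤ h s := by nlinarith
    have h21 : ε ^ 2 * exp (-M) ≤ ε := by
      calc ε ^ 2 * exp (-M) ≤ ε ^ 2 * 1 := mul_le_mul_of_nonneg_left hek (sq_nonneg _)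
        _ = ε * ε := by ring
        _ ≤ ε * 1 := mul_le_mul_of_nonneg_left hε1 hε.le
        _ = ε := mul_one _
    have hεe : 0 ≤ ε ^ 2 * exp (-M) := by positivity
    have h22 : |X s 0 ^ 2 * X s 2| ≤ h s := by
      rw [abs_mul, abs_of_nonneg ha0]; nlinarith [abs_nonneg (X s 2), hc_le s]
    have h23 : ε ^ 2 * exp (-M) * (X s 0 ^ 2 * X s 2) ≤ ε * h s := by
      calc ε ^ 2 * exp (-M) * (X s 0 ^ 2 * X s 2)
          ≤ ε ^ 2 * exp (-M) * |X s 0 ^ 2 * X s 2| :=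
            mul_le_mul_of_nonneg_left (le_abs_self _) hεe
        _ ≤ ε * h s := mul_le_mul h21 h22 (abs_nonneg _) hε.le
    have hD : 0 ≤ 2 * E s 1 * X s 1 ^ 2 + 2 * E s 2 * X s 2 ^ 2 := by
      have := (hE s hs 1).1; have := (hE s hs 2).1; positivity
    have h1' : 2 * ε * X s 0 ^ 2 * X s 1 ≤ 2 * ε * h s := by nlinarith
    have : h s = sqrt (f s + ρ) := rfl
    rw [← this]
    nlinarith
  -- `h - 2εt` is antitone on `[0,2]`
  have hanti := antitoneOn_sub_of_deriv_le (convex_Icc 0 2) hder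
    (fun s _ => ((hasDerivAt_id s).const_mul (2 * ε))) (fun s hs => by simpa using hbound s hs)
  have h0mem : (0 : ℝ) ∈ Icc (0 : ℝ) 2 := ⟨le_rfl, by norm_num⟩
  have hmono := hanti h0mem ht ht.1
  have hh0' : h 0 = ε := by
    have : f 0 + ρ = ε ^ 2 := by simp only [hf, hρ, h0.2.2.2.2.1]; ring
    simp only [hh, this]
    exact sqrt_sq hε.le
  simp only [hh0', id, mul_zero, sub_zero] at hmono
  have hht : h t ≤ 5 * ε := by
    have := ht.2
    nlinarith
  exact ⟨(hb_le t).trans hht, (hc_le t).trans hht⟩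

/-- `c ≥ 0` on `[0,2]`: the sign barrier with `L = 5M`. [cite: Tao2016AveragedNS, §5.5 proof] -/
theorem c_nonneg
    (hX : ∀ t ∈ Icc (0:ℝ) 2, HasDerivAt X (delayCircuitWith K M ε (X t) - E t * X t) t)
    (hE : ∀ t ∈ Icc (0:ℝ) 2, ∀ i, 0 ≤ E t i ∧ E t i ≤ η)
    (h0 : X 0 0 ^ 2 + X 0 1 ^ 2 = 1 ∧ 0 ≤ X 0 0 ∧ -(1 / 5 * ε) ≤ X 0 1 ∧ X 0 1 ≤ 2 / 5 * ε ∧ X 0 2 = 0 ∧ X 0 3 = 0 ∧ X 0 4 = 0)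
    (hε : 0 < ε) (hε1 : ε ≤ 1) (hM0 : 0 ≤ M) {t : ℝ} (ht : t ∈ Icc 0 2) : 0 ≤ X t 2 := by
  refine nonneg_of_deriv_barrier (L := 5 * M) (b := 2) (by positivity)
    (fun s hs => hasDerivAt_c (hX s hs)) (by rw [h0.2.2.2.2.1]) (fun s hs hcs => ?_) ht
  have hb : |X s 1| ≤ 5 * ε := (bc_small hX hE h0 hε hε1 hM0 ⟨hs.1, hs.2.le⟩).1
  have hνb : |ε⁻¹ * M * X s 1| ≤ 5 * M := by
    rw [abs_mul, abs_of_nonneg (by positivity : 0 ≤ ε⁻¹ * M)]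
    calc ε⁻¹ * M * |X s 1| ≤ ε⁻¹ * M * (5 * ε) := mul_le_mul_of_nonneg_left hb (by positivity)
      _ = 5 * M := by field_simp
  have h1 : 5 * M * X s 2 ≤ ε⁻¹ * M * X s 1 * X s 2 := by
    have hle : ε⁻¹ * M * X s 1 ≤ 5 * M := (le_abs_self _).trans hνb
    nlinarith
  have h2 : 0 ≤ -(E s 2 * X s 2) := by
    rw [neg_nonneg]; exact mul_nonpos_of_nonneg_of_nonpos (hE s ⟨hs.1, hs.2.le⟩ 2).1 hcs.le
  have h3 : 0 ≤ ε ^ 2 * exp (-M) * X s 0 ^ 2 := by positivity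
  linarith

/-- (code) from the class: `c(t) ≤ 2ε² e^{(5t-1)M}` on `[0,2]`. [cite: Tao2016AveragedNS, §5.5 (code)] -/
theorem c_crude
    (hX : ∀ t ∈ Icc (0:ℝ) 2, HasDerivAt X (delayCircuitWith K M ε (X t) - E t * X t) t)
    (hE : ∀ t ∈ Icc (0:ℝ) 2, ∀ i, 0 ≤ E t i ∧ E t i ≤ η)
    (h0 : X 0 0 ^ 2 + X 0 1 ^ 2 = 1 ∧ 0 ≤ X 0 0 ∧ -(1 / 5 * ε) ≤ X 0 1 ∧ X 0 1 ≤ 2 / 5 * ε ∧ X 0 2 = 0 ∧ X 0 3 = 0 ∧ X 0 4 = 0)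
    (hε : 0 < ε) (hε1 : ε ≤ 1) (hM0 : 0 ≤ M) {t : ℝ} (ht : t ∈ Icc 0 2) :
    X t 2 ≤ 2 * ε ^ 2 * exp ((5 * t - 1) * M) := by
  set μ := ε ^ 2 * exp (-M) with hμ
  have hμ0 : 0 ≤ μ := by positivity
  have hanti := antitoneOn_intFactor (s := Icc 0 2) (g := fun _ => 5 * M)
    (G := fun s => 5 * M * s) (φ := fun _ => μ) (Φ := fun s => μ * s) (convex_Icc 0 2)
    (fun s hs => hasDerivAt_c (hX s hs))
    (fun s _ => ((hasDerivAt_id s).const_mul (5 * M)).congr_deriv (by simp))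
    (fun s _ => ((hasDerivAt_id s).const_mul μ).congr_deriv (by simp))
    (fun s hs => by
      have hc0 : 0 ≤ X s 2 := c_nonneg hX hE h0 hε hε1 hM0 hs
      have hb : |X s 1| ≤ 5 * ε := (bc_small hX hE h0 hε hε1 hM0 hs).1
      have ha : X s 0 ^ 2 ≤ 1 := traj_sq_le_one hX hE h0 hs 0
      have hexp : exp (-(5 * M * s)) ≤ 1 := by
        rw [exp_le_one_iff, neg_nonpos]; have := hs.1; positivity
      have h1 : ε ^ 2 * exp (-M) * X s 0 ^ 2 ≤ μ := by
        simpa [hμ] using mul_le_mul_of_nonneg_left ha (by positivity : 0 ≤ ε ^ 2 * exp (-M))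
      have h2 : ε⁻¹ * M * X s 1 * X s 2 ≤ 5 * M * X s 2 := by
        have hb' : X s 1 ≤ 5 * ε := (le_abs_self _).trans hb
        have h5 : ε⁻¹ * X s 1 ≤ 5 := by rw [inv_mul_le_iff₀ hε]; linarith
        have : ε⁻¹ * M * X s 1 * X s 2 = (ε⁻¹ * X s 1) * (M * X s 2) := by ring
        rw [this]
        nlinarith [mul_nonneg hM0 hc0]
      have h3 : -(E s 2 * X s 2) ≤ 0 := by
        rw [neg_nonpos]; exact mul_nonneg (hE s hs 2).1 hc0
      have hbr : ε ^ 2 * exp (-M) * X s 0 ^ 2 + ε⁻¹ * M * X s 1 * X s 2 - E s 2 * X s 2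
          - 5 * M * X s 2 ≤ μ := by linarith
      calc (ε ^ 2 * exp (-M) * X s 0 ^ 2 + ε⁻¹ * M * X s 1 * X s 2 - E s 2 * X s 2
            - 5 * M * X s 2) * exp (-(5 * M * s))
          ≤ μ * exp (-(5 * M * s)) := mul_le_mul_of_nonneg_right hbr (exp_pos _).le
        _ ≤ μ * 1 := mul_le_mul_of_nonneg_left hexp hμ0
        _ = μ := mul_one _)
  have h0mem : (0 : ℝ) ∈ Icc (0 : ℝ) 2 := ⟨le_rfl, by norm_num⟩
  have h := hanti h0mem ht ht.1
  simp only [h0.2.2.2.2.1, zero_mul, mul_zero, sub_zero] at h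
  have h' : X t 2 * exp (-(5 * M * t)) ≤ μ * t := by linarith
  have hexp : X t 2 = X t 2 * exp (-(5 * M * t)) * exp (5 * M * t) := by
    rw [mul_assoc, ← exp_add, neg_add_cancel, exp_zero, mul_one]
  rw [hexp]
  calc X t 2 * exp (-(5 * M * t)) * exp (5 * M * t)
      ≤ μ * t * exp (5 * M * t) := mul_le_mul_of_nonneg_right h' (exp_pos _).le
    _ ≤ μ * 2 * exp (5 * M * t) := by
        have := ht.2
        exact mul_le_mul_of_nonneg_right (mul_le_mul_of_nonneg_left this hμ0) (exp_pos _).le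
    _ = 2 * ε ^ 2 * exp ((5 * t - 1) * M) := by
        simp only [hμ]
        rw [show (5 * t - 1) * M = -M + 5 * M * t by ring, exp_add]
        ring

end Trajectory

end HeadStart

end Summit.NavierStokesRegularity.FluidComputer
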